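import Mathlib
import Summits.AnomalousDissipation.AnomalousDissipation.Statement
import Literature.Analysis.FluidPDE.GalerkinEnergyBalanceLongTime

/-!
# The steady door to the zeroth law

The reduction behind the solo-blind programme (paper `steady-zeroth-law.md`, §24: the STEADY DOOR):
the summit `AnomalousDissipation = Literature.Turb.ZerothLaw` follows from the existence of ONE
smooth steady force `f` and a sequence of viscosities `νⱼ → 0` carrying STEADY states `Uⱼ`
(time-independent global Leray–Hopf solutions forced by `f`, started from themselves) whose
energies are bounded and whose dissipation rates `νⱼ ‖∇Uⱼ‖₂²` are bounded below, uniformly in `j`.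
For a time-independent flow the long-time `limsup` means are the instantaneous values, so the
summit's Cesàro clauses reduce to pointwise bounds.  The analytic content of the programme is the
construction of such `Uⱼ` (3D steady Navier–Stokes states on thin boxes `T² × (T/n)`, which are
in particular `T³`-periodic); this file records only the door, typed against the audited statement.
-/

namespace Summit.AnomalousDissipation.AnomalousDissipation.Theorems

open MeasureTheory Filter Topology
open Literature.Analysis Literature.Analysis.FluidPDE

/-- **Steady door.** If a fixed smooth, divergence-free, mean-zero force `f` on `T³` admits, along
some viscosities `νⱼ > 0`, `νⱼ → 0`, time-independent global Leray–Hopf solutions `Uⱼ` with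
`∫ ‖Uⱼ‖² ≤ E` and `νⱼ ‖∇Uⱼ‖₂² ≥ ε > 0` for all `j`, then the zeroth law (`AnomalousDissipation`) holds. -/
theorem steady_door
    (f : UnitAddTorus (Fin 3) → EuclideanSpace ℝ (Fin 3))
    (hfs : FunctionSpaces.Torus.IsSmooth f) (hfd : FunctionSpaces.Torus.IsDivFree f)
    (hfm : FunctionSpaces.Torus.HasZeroMean f)
    (ν : ℕ → ℝ) (hνpos : ∀ j, 0 < ν j) (hν0 : Tendsto ν atTop (𝓝 0))
    (U : ℕ → UnitAddTorus (Fin 3) → EuclideanSpace ℝ (Fin 3))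
    (hLH : ∀ j, FluidPDE.Torus.IsGlobalLerayHopf (ν j) (fun _ => f) (U j) (fun _ => U j))
    (E : ℝ) (hE : ∀ j, ∫ x, ‖U j x‖ ^ 2 ≤ E)
    (ε : ℝ) (hε : 0 < ε)
    (hD : ∀ j, ε ≤ ν j * (FunctionSpaces.Torus.eGradNormSq (U j)).toReal) :
    AnomalousDissipation := by
  refine ⟨f, hfs, hfd, hfm, ν, U, fun j _ => U j, hνpos, hν0, hLH, ⟨E, fun j => ?_⟩, ⟨ε, hε, fun j => ?_⟩⟩
  · rw [meanEnergy_eq_longTimeAvgSup,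
      longTimeAvgSup_of_eq_const (c := ∫ x, ‖U j x‖ ^ 2) (fun t _ => rfl)]
    exact hE j
  · unfold meanDissipation
    rw [longTimeAvgSup_of_eq_const (c := ν j * (FunctionSpaces.Torus.eGradNormSq (U j)).toReal)
      (fun t _ => rfl)]
    exact hD j

/-- The same door phrased with the steady states indexed by the thin-box parameter: any sequence
works, in particular `νₙ = K₀/n²` (`K₀ > 0`), the scaling of the columnar programme. -/
theorem steady_door_thinbox_scaling (K₀ : ℝ) (hK : 0 < K₀) :
    Tendsto (fun n : ℕ => K₀ / ((n : ℝ) + 1) ^ 2) atTop (𝓝 0) ∧ ∀ n : ℕ, 0 < K₀ / ((n : ℝ) + 1) ^ 2 := by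
  refine ⟨?_, fun n => by positivity⟩
  have h1 : Tendsto (fun n : ℕ => ((n : ℝ) + 1) ^ 2) atTop atTop := by
    have : Tendsto (fun n : ℕ => (n : ℝ) + 1) atTop atTop :=
      tendsto_atTop_add_const_right _ 1 tendsto_natCast_atTop_atTop
    exact this.atTop_mul_atTop₀ this |>.congr (fun n => by ring)
  have := h1.inv_tendsto_atTop
  have h2 := this.const_mul K₀
  simp only [mul_zero] at h2
  exact h2.congr (fun n => by simp [div_eq_mul_inv])

end Summit.AnomalousDissipation.AnomalousDissipation.Theorems
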